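import Mathlib
import Literature.NumberTheory.GaloisRepresentations.HeckeCharacterValueFieldProofs
import Literature.NumberTheory.GaloisRepresentations.AlgebraicHeckeCharacterNormValues

/-!
# Algebraic Hecke characters of a totally complex field: `N𝔞 · χ̃(𝔞)` on the ray and its integrality

Helper file for item stmt-Langlands-13760 (route `PicardMuOrdinary`, decl `ResidualAutomorphyEven`).
Let `L` be a totally complex number field and `χ` a Hecke character of `L` of infinity type `(p, q)`
(`HeckeCharacter.HasInfinityType`: `χ((x,1)) = ∏_w ι_w(x_w)^{-p_w} \overline{ι_w(x_w)}^{-q_w}` near `1`)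
with module of definition `(T, e)`, `𝔪 = 𝔪(T, e)`, and assume `1 + p_w ≥ 0`, `1 + q_w ≥ 0` for all
`w`.  Write `χ̃(𝔞) = ∏_𝔭 χ(ϖ_𝔭)^{v_𝔭(𝔞)}` (`LFunctions.idealPow`), `Ψ(𝔞) = N𝔞 · χ̃(𝔞)` and
`B(x) = ∏_w σ_w(x)^{1+p_w} \overline{σ_w(x)}^{1+q_w}` (`embProd`).  Since `N((x)) = ∏_w σ_w(x) \overline{σ_w(x)}`
for a totally complex field (`absNorm_span_singleton_eq_prod_embedding`) and
`χ̃((b)) = χ̃((c)) ∏_w σ_w(b/c)^{p_w} \overline{σ_w(b/c)}^{q_w}` on the ray (the tree's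
`HasInfinityType.idealPow_span_eq`, Weil / Neukirch VII (6.13)–(6.14)):

* `Psi_span_mul_embProd_eq` — `Ψ((b)) · B(c) = Ψ((c)) · B(b)` for `b ≡ c mod 𝔪`, `c` prime to `𝔪`;
* `Psi_span_eq_embProd` — `Ψ((b)) = B(b)` for `b ≡ 1 mod 𝔪`;
* `exists_pow_residueCard_mul_valueAtUniformizer_eq_embProd` — for `v ∉ T` some power
  `(N v · χ(ϖ_v))^n`, `n ≥ 1`, is `B(b)` with `b ≡ 1 mod 𝔪` (`𝔭_v^{hk} = (g^k)`, `h` the class number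
  exponent, `k = #(𝓞_L/𝔪)ˣ`);
* `isIntegral_residueCard_mul_valueAtUniformizer` — hence `N v · χ(ϖ_v)` is an algebraic integer.
-/

set_option linter.dupNamespace false -- project-wide option (lakefile weak.linter.dupNamespace); `Summit.Langlands.Langlands` is the mandated namespace

noncomputable section

namespace Summit.Langlands.Langlands.Theorems.ResidualAutomorphyEven

open NumberField NumberField.InfinitePlace IsDedekindDomain Filter
open Literature.NumberTheory.GaloisRepresentations Literature.NumberTheory.LFunctions
open scoped ComplexConjugate Classical

variable {L : Type*} [Field L] [NumberField L]

/-! ### The archimedean monomial `B(x) = ∏_w σ_w(x)^{a_w} \overline{σ_w(x)}^{b_w}` -/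

/-- `B_{a,b}(x) = ∏_w σ_w(x)^{a_w} \overline{σ_w(x)}^{b_w}` (natural exponents). -/
def embProd (a b : InfinitePlace L → ℕ) (x : L) : ℂ :=
  ∏ w : InfinitePlace L, w.embedding x ^ a w * conj (w.embedding x) ^ b w

/-- `B(1) = 1`. -/
theorem embProd_one (a b : InfinitePlace L → ℕ) : embProd a b (1 : L) = 1 := by
  simp [embProd]

/-- `B(xy) = B(x) B(y)`. -/
theorem embProd_mul (a b : InfinitePlace L → ℕ) (x y : L) : embProd a b (x * y) = embProd a b x * embProd a b y := by
  simp only [embProd, map_mul, mul_pow, ← Finset.prod_mul_distrib]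
  refine Finset.prod_congr rfl fun w _ => ?_
  ring

/-- `B(xⁿ) = B(x)ⁿ`. -/
theorem embProd_pow (a b : InfinitePlace L → ℕ) (x : L) (n : ℕ) : embProd a b (x ^ n) = embProd a b x ^ n := by
  induction n with
  | zero => rw [pow_zero, pow_zero, embProd_one]
  | succ n ih => rw [pow_succ, embProd_mul, ih, pow_succ]

/-- `B(x) ≠ 0` for `x ≠ 0`. -/
theorem embProd_ne_zero (a b : InfinitePlace L → ℕ) {x : L} (hx : x ≠ 0) : embProd a b x ≠ 0 := by
  refine Finset.prod_ne_zero_iff.mpr fun w _ => mul_ne_zero (pow_ne_zero _ ?_) (pow_ne_zero _ ?_)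
  · exact (map_ne_zero _).mpr hx
  · exact (map_ne_zero _).mpr ((map_ne_zero _).mpr hx)

/-- `B(x)` is an algebraic integer for `x ∈ 𝓞_L`. -/
theorem isIntegral_embProd (a b : InfinitePlace L → ℕ) (x : 𝓞 L) : IsIntegral ℤ (embProd a b (x : L)) := by
  refine IsIntegral.prod _ fun w _ => IsIntegral.mul (IsIntegral.pow ?_ _) (IsIntegral.pow ?_ _)
  · exact (RingOfIntegers.isIntegral_coe x).map w.embedding.toIntAlgHom
  · rw [← ComplexEmbedding.conjugate_coe_eq]
    exact (RingOfIntegers.isIntegral_coe x).map (ComplexEmbedding.conjugate w.embedding).toIntAlgHom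

/-! ### Totally complex fields: no real embeddings, `N((x)) = ∏_w σ_w(x) \overline{σ_w(x)}` -/

section TotallyComplex

variable [IsTotallyComplex L]

omit [NumberField L] in
/-- A totally complex field has no ring homomorphism to `ℝ`. -/
theorem isEmpty_ringHom_real : IsEmpty (L →+* ℝ) := by
  refine ⟨fun φ => ?_⟩
  have hreal : ComplexEmbedding.IsReal ((algebraMap ℝ ℂ).comp φ) := by
    ext x
    simp
  have hw : (InfinitePlace.mk ((algebraMap ℝ ℂ).comp φ)).IsReal := ⟨_, hreal, rfl⟩
  exact (InfinitePlace.not_isReal_iff_isComplex.mpr (IsTotallyComplex.isComplex _)) hw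

omit [NumberField L] in
/-- The positivity side condition of the ray is vacuous in a totally complex field. -/
theorem forall_ringHom_real_pos (b c : 𝓞 L) : ∀ φ : L →+* ℝ, 0 < φ b * φ c := fun φ =>
  (isEmpty_ringHom_real (L := L)).elim φ

/-- **`N((x)) = ∏_w σ_w(x) \overline{σ_w(x)}`** in a totally complex field (`|N_{L/ℚ}(x)| = ∏_w |σ_w x|²`). -/
theorem absNorm_span_singleton_eq_prod_embedding (x : 𝓞 L) :
    ((Ideal.absNorm (Ideal.span {x}) : ℕ) : ℂ) = ∏ w : InfinitePlace L, w.embedding (x : L) * conj (w.embedding (x : L)) := by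
  have h1 : ((Ideal.absNorm (Ideal.span {x}) : ℕ) : ℝ) = |Algebra.norm ℚ (x : L)| := by
    rw [Ideal.absNorm_span_singleton, ← Algebra.coe_norm_int, ← Int.cast_abs, Nat.cast_natAbs]
    push_cast
    rfl
  have h2 : |Algebra.norm ℚ (x : L)| = ((∏ w : InfinitePlace L, w (x : L) ^ w.mult : ℝ) : ℝ) := by
    rw [prod_eq_abs_norm]
  have h3 : ∀ w : InfinitePlace L, ((w (x : L) : ℝ) : ℂ) ^ w.mult = w.embedding (x : L) * conj (w.embedding (x : L)) := by
    intro w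
    rw [mult, if_neg (InfinitePlace.not_isReal_iff_isComplex.mpr (IsTotallyComplex.isComplex w)),
      ← norm_embedding_eq, Complex.mul_conj, Complex.normSq_eq_norm_sq, Complex.ofReal_pow]
  have h : ((Ideal.absNorm (Ideal.span {x}) : ℕ) : ℂ) = (((Ideal.absNorm (Ideal.span {x}) : ℕ) : ℝ) : ℂ) := by
    norm_cast
  rw [h, h1, h2]
  push_cast
  exact Finset.prod_congr rfl fun w _ => h3 w

end TotallyComplex

/-! ### `Ψ(𝔞) = N𝔞 · χ̃(𝔞)` on the ray -/

section Psi

variable {χ : HeckeCharacter L} {p q : InfinitePlace L → ℤ}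
  {T : Finset (HeightOneSpectrum (𝓞 L))} {e : HeightOneSpectrum (𝓞 L) → ℕ}

/-- `Ψ(𝔞) = N𝔞 · χ̃(𝔞)`. -/
def Psi (χ : HeckeCharacter L) (𝔞 : Ideal (𝓞 L)) : ℂ :=
  (Ideal.absNorm 𝔞 : ℂ) * idealPow L (fun v => χ.valueAtUniformizer v) 𝔞

/-- `Ψ` is multiplicative on nonzero ideals. -/
theorem Psi_mul (χ : HeckeCharacter L) {I J : Ideal (𝓞 L)} (hI : I ≠ ⊥) (hJ : J ≠ ⊥) :
    Psi χ (I * J) = Psi χ I * Psi χ J := by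
  rw [Psi, Psi, Psi, map_mul, Nat.cast_mul, idealPow_mul _ hI hJ]
  ring

/-- `Ψ(Iⁿ) = Ψ(I)ⁿ`. -/
theorem Psi_pow (χ : HeckeCharacter L) {I : Ideal (𝓞 L)} (hI : I ≠ ⊥) (n : ℕ) : Psi χ (I ^ n) = Psi χ I ^ n := by
  rw [Psi, Psi, map_pow, Nat.cast_pow, idealPow_pow _ hI, mul_pow]

/-- `Ψ(𝔭_v) = N v · χ(ϖ_v)`. -/
theorem Psi_asIdeal (χ : HeckeCharacter L) (v : HeightOneSpectrum (𝓞 L)) :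
    Psi χ v.asIdeal = (v.residueCard : ℂ) * χ.valueAtUniformizer v := by
  rw [Psi, idealPow_asIdeal, HeightOneSpectrum.residueCard]

/-- `Ψ(𝔞) ≠ 0` for `𝔞 ≠ 0`. -/
theorem Psi_ne_zero (χ : HeckeCharacter L) {I : Ideal (𝓞 L)} (hI : I ≠ ⊥) : Psi χ I ≠ 0 := by
  refine mul_ne_zero ?_ (HeckeCharacter.idealPow_ne_zero (HeckeCharacter.valueAtUniformizer_ne_zero' χ) I)
  exact_mod_cast (Ideal.absNorm_eq_zero_iff.not.mpr hI)

/-- The exponent `(1 + p).toNat` as an integer is `1 + p` when `0 ≤ 1 + p`. -/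
theorem zpow_toNat_eq {z : ℂ} {n : ℤ} (hn : 0 ≤ n) : z ^ n.toNat = z ^ n := by
  conv_rhs => rw [← Int.toNat_of_nonneg hn]
  exact (zpow_natCast z n.toNat).symm

/-- The one-place identity behind `Psi_span_mul_embProd_eq`: for nonzero `s, t, u, v` and `1 + p, 1 + q ≥ 0`,
`s t · (s/u)^p (t/v)^q · u^{1+p} v^{1+q} = u v · s^{1+p} t^{1+q}`. -/
theorem place_identity {s t u v : ℂ} (hs : s ≠ 0) (ht : t ≠ 0) (hu : u ≠ 0) (hv : v ≠ 0) {p q : ℤ}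
    (hp : 0 ≤ 1 + p) (hq : 0 ≤ 1 + q) :
    s * t * ((s / u) ^ p * (t / v) ^ q) * (u ^ (1 + p).toNat * v ^ (1 + q).toNat) =
      u * v * (s ^ (1 + p).toNat * t ^ (1 + q).toNat) := by
  rw [zpow_toNat_eq hp, zpow_toNat_eq hq, zpow_toNat_eq hp, zpow_toNat_eq hq, zpow_add₀ hu, zpow_add₀ hv,
    zpow_add₀ hs, zpow_add₀ ht, zpow_one, zpow_one, zpow_one, zpow_one, div_zpow, div_zpow]
  have hup : u ^ p ≠ 0 := zpow_ne_zero _ hu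
  have hvq : v ^ q ≠ 0 := zpow_ne_zero _ hv
  field_simp

variable [IsTotallyComplex L]

/-- **`Ψ((b)) · B(c) = Ψ((c)) · B(b)` on the ray `b ≡ c mod 𝔪`** (`c` prime to `𝔪 = 𝔪(T, e)`), for `χ` of
infinity type `(p, q)` with `1 + p_w, 1 + q_w ≥ 0` and `B = B_{1+p, 1+q}`. -/
theorem Psi_span_mul_embProd_eq (hinf : χ.HasInfinityType p q) (hmod : HeckeCharacter.IsModulus χ T e)
    (hp : ∀ w, 0 ≤ 1 + p w) (hq : ∀ w, 0 ≤ 1 + q w) {b c : 𝓞 L} (hb : b ≠ 0) (hc : c ≠ 0)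
    (hcop : IsCoprime (Ideal.span {c}) (HeckeCharacter.modulusIdeal T e)) (hbc : b - c ∈ HeckeCharacter.modulusIdeal T e) :
    Psi χ (Ideal.span {b}) * embProd (fun w => (1 + p w).toNat) (fun w => (1 + q w).toNat) (c : L) =
      Psi χ (Ideal.span {c}) * embProd (fun w => (1 + p w).toNat) (fun w => (1 + q w).toNat) (b : L) := by
  have key := hinf.idealPow_span_eq hmod hb hc hcop hbc (forall_ringHom_real_pos b c)
  rw [Psi, Psi, key, absNorm_span_singleton_eq_prod_embedding, absNorm_span_singleton_eq_prod_embedding, embProd,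
    embProd]
  -- rearrange into a product over the places of a one-place identity
  have hb' : (b : L) ≠ 0 := fun h => hb (by exact_mod_cast h)
  have hc' : (c : L) ≠ 0 := fun h => hc (by exact_mod_cast h)
  set Ic := idealPow L (fun v => χ.valueAtUniformizer v) (Ideal.span {c}) with hIc
  set sb : InfinitePlace L → ℂ := fun w => w.embedding (b : L) with hsb
  set sc : InfinitePlace L → ℂ := fun w => w.embedding (c : L) with hsc
  have hdiv : ∀ w : InfinitePlace L, w.embedding ((b : L) / c) = sb w / sc w := fun w => by
    rw [hsb, hsc, map_div₀]
  simp only [hdiv]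
  have hplace : ∀ w : InfinitePlace L,
      sb w * conj (sb w) * ((sb w / sc w) ^ p w * (conj (sb w / sc w)) ^ q w) *
          (sc w ^ (1 + p w).toNat * conj (sc w) ^ (1 + q w).toNat) =
        sc w * conj (sc w) * (sb w ^ (1 + p w).toNat * conj (sb w) ^ (1 + q w).toNat) := fun w => by
    rw [map_div₀]
    exact place_identity ((map_ne_zero _).mpr hb') ((map_ne_zero _).mpr ((map_ne_zero _).mpr hb'))
      ((map_ne_zero _).mpr hc') ((map_ne_zero _).mpr ((map_ne_zero _).mpr hc')) (hp w) (hq w)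
  have hL : (∏ w : InfinitePlace L, sb w * conj (sb w)) * (Ic * ∏ w : InfinitePlace L, (sb w / sc w) ^ p w * conj (sb w / sc w) ^ q w) *
        ∏ w : InfinitePlace L, sc w ^ (1 + p w).toNat * conj (sc w) ^ (1 + q w).toNat =
      Ic * ∏ w : InfinitePlace L, (sb w * conj (sb w) * ((sb w / sc w) ^ p w * (conj (sb w / sc w)) ^ q w) *
          (sc w ^ (1 + p w).toNat * conj (sc w) ^ (1 + q w).toNat)) := by
    simp only [Finset.prod_mul_distrib]; ring
  have hR : (∏ w : InfinitePlace L, sc w * conj (sc w)) * Ic *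
        ∏ w : InfinitePlace L, sb w ^ (1 + p w).toNat * conj (sb w) ^ (1 + q w).toNat =
      Ic * ∏ w : InfinitePlace L, (sc w * conj (sc w) * (sb w ^ (1 + p w).toNat * conj (sb w) ^ (1 + q w).toNat)) := by
    simp only [Finset.prod_mul_distrib]; ring
  rw [hL, hR]
  exact congrArg _ (Finset.prod_congr rfl fun w _ => hplace w)

/-- **`Ψ((b)) = B(b)` for `b ≡ 1 mod 𝔪`.** -/
theorem Psi_span_eq_embProd (hinf : χ.HasInfinityType p q) (hmod : HeckeCharacter.IsModulus χ T e)
    (hp : ∀ w, 0 ≤ 1 + p w) (hq : ∀ w, 0 ≤ 1 + q w) {b : 𝓞 L} (hb : b ≠ 0)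
    (hb1 : b - 1 ∈ HeckeCharacter.modulusIdeal T e) :
    Psi χ (Ideal.span {b}) = embProd (fun w => (1 + p w).toNat) (fun w => (1 + q w).toNat) (b : L) := by
  have htop : Ideal.span {(1 : 𝓞 L)} = ⊤ := Ideal.span_singleton_one
  have hcop : IsCoprime (Ideal.span {(1 : 𝓞 L)}) (HeckeCharacter.modulusIdeal T e) := by
    rw [htop, ← Ideal.one_eq_top]; exact isCoprime_one_left
  have h := Psi_span_mul_embProd_eq hinf hmod hp hq hb one_ne_zero hcop hb1
  have h1 : Psi χ (Ideal.span {(1 : 𝓞 L)}) = 1 := by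
    rw [Psi, htop, idealPow_top, Ideal.absNorm_top, Nat.cast_one, one_mul]
  have h2 : embProd (fun w => (1 + p w).toNat) (fun w => (1 + q w).toNat) ((1 : 𝓞 L) : L) = 1 := by
    rw [RingOfIntegers.coe_eq_algebraMap, map_one, embProd_one]
  rwa [h2, mul_one, h1, one_mul] at h

/-- **A power of `N v · χ(ϖ_v)` is an archimedean monomial of an element of the ray**: for `v ∉ T` there
are `n ≥ 1` and `b ∈ 𝓞_L`, `b ≠ 0`, `b ≡ 1 mod 𝔪`, with `(N v · χ(ϖ_v))^n = B(b)` (indeed `𝔭_v^n = (b)`). -/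
theorem exists_pow_residueCard_mul_valueAtUniformizer_eq_embProd (hinf : χ.HasInfinityType p q)
    (hmod : HeckeCharacter.IsModulus χ T e) (hp : ∀ w, 0 ≤ 1 + p w) (hq : ∀ w, 0 ≤ 1 + q w)
    {v : HeightOneSpectrum (𝓞 L)} (hv : v ∉ T) :
    ∃ (n : ℕ) (b : 𝓞 L), 0 < n ∧ b ≠ 0 ∧ b - 1 ∈ HeckeCharacter.modulusIdeal T e ∧ v.asIdeal ^ n = Ideal.span {b} ∧
      ((v.residueCard : ℂ) * χ.valueAtUniformizer v) ^ n =
        embProd (fun w => (1 + p w).toNat) (fun w => (1 + q w).toNat) (b : L) := by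
  set 𝔪 := HeckeCharacter.modulusIdeal T e with h𝔪def
  have h𝔪 : 𝔪 ≠ ⊥ := HeckeCharacter.modulusIdeal_ne_bot T e
  obtain ⟨h, hh, hgen⟩ := exists_forall_span_singleton_eq_pow L
  obtain ⟨g, hg⟩ := hgen v
  have hg0 : g ≠ 0 := by
    intro h0
    rw [h0, Ideal.span_singleton_zero] at hg
    exact pow_ne_zero h v.ne_bot hg.symm
  -- `g` is prime to `𝔪`, hence a unit modulo `𝔪`
  have hcopv : IsCoprime (v.asIdeal ^ h) 𝔪 := (HeckeCharacter.isCoprime_asIdeal_modulusIdeal hv).pow_left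
  have hcopg : IsCoprime (Ideal.span {g}) 𝔪 := by rwa [hg]
  haveI : Finite (𝓞 L ⧸ 𝔪) := Ideal.finiteQuotientOfFreeOfNeBot 𝔪 h𝔪
  set k := Nat.card (𝓞 L ⧸ 𝔪)ˣ with hk
  have hkpos : 0 < k := Nat.card_pos
  have hunit : IsUnit (Ideal.Quotient.mk 𝔪 g) := by
    obtain ⟨x, hx, y, hy, hxy⟩ := Ideal.isCoprime_iff_exists.mp hcopg
    obtain ⟨r, rfl⟩ := Ideal.mem_span_singleton'.mp hx
    refine IsUnit.of_mul_eq_one (Ideal.Quotient.mk 𝔪 r) ?_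
    rw [← map_mul, ← map_one (Ideal.Quotient.mk 𝔪), Ideal.Quotient.eq]
    have : g * r - 1 = -y := by rw [← hxy]; ring
    rw [this]
    exact 𝔪.neg_mem hy
  obtain ⟨u, hu⟩ := hunit
  have hgk : g ^ k - 1 ∈ 𝔪 := by
    rw [← Ideal.Quotient.eq, map_pow, ← hu, ← Units.val_pow_eq_pow_val, pow_card_eq_one', Units.val_one, map_one]
  refine ⟨h * k, g ^ k, Nat.mul_pos hh hkpos, pow_ne_zero _ hg0, hgk, ?_, ?_⟩
  · rw [pow_mul, ← hg, Ideal.span_singleton_pow]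
  · rw [← Psi_asIdeal, ← Psi_pow χ v.ne_bot, pow_mul, ← hg, Ideal.span_singleton_pow,
      Psi_span_eq_embProd hinf hmod hp hq (pow_ne_zero _ hg0) hgk, RingOfIntegers.coe_eq_algebraMap, map_pow,
      ← RingOfIntegers.coe_eq_algebraMap]

/-- **`N v · χ(ϖ_v)` is an algebraic integer** for `v` off the module of definition, when `χ` has infinity
type `(p, q)` with `1 + p_w, 1 + q_w ≥ 0` on a totally complex field. -/
theorem isIntegral_residueCard_mul_valueAtUniformizer (hinf : χ.HasInfinityType p q)
    (hmod : HeckeCharacter.IsModulus χ T e) (hp : ∀ w, 0 ≤ 1 + p w) (hq : ∀ w, 0 ≤ 1 + q w)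
    {v : HeightOneSpectrum (𝓞 L)} (hv : v ∉ T) :
    IsIntegral ℤ ((v.residueCard : ℂ) * χ.valueAtUniformizer v) := by
  obtain ⟨n, b, hn, -, -, -, heq⟩ := exists_pow_residueCard_mul_valueAtUniformizer_eq_embProd hinf hmod hp hq hv
  refine IsIntegral.of_pow hn ?_
  rw [heq]
  exact isIntegral_embProd _ _ b

end Psi

end Summit.Langlands.Langlands.Theorems.ResidualAutomorphyEven
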